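import Summits.Ventures.CertifiedManyBodySolver.Rows.HomTorusMagWindowGauge
import Summits.Ventures.CertifiedManyBodySolver.Rows.HomTorusSpinMagModel
import HarnessLib

/-!
# Spin-twisted torus ceiling III — the window gauge for SPIN-twisted tori generated by hop vectors

HONEST FRAMING: first certified bounds; not a superconductivity verdict; every number certified or
labelled float.
`Rows/HomTorusMagWindowGauge.lean` with one twist character PER SPECIES: for a uniform spin-dependent
Peierls field `κ : Fin d → Fin 2 → U(1)` (Part II, `HomTorusSpinMagModel`), characters `χ(·, σ)` of
`ℤ^d` with `χ(eᵢ, σ) = κ i σ` and a window gauge `ĝ : site → spin → U(1)` with `ĝ(φ x) = χ(x)` on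
`Λ'`, the ORBITAL gauge automorphism `Ad(W_ĝ)` (`Rows/OrbGaugeAut.lean`) composed with `Γ(ι_{Λ'})`
carries a field-free window certificate into the spin-twisted torus `H_κ`:
(i) the gauged tiling identity `Σ_v T_v (Ad(W_ĝ) Γ E_Φ) T_vᴴ = H_κ`; (ii) the gauge defect
`H_{ĝ·κ} − H_1` is even and supported off `φ(Λ)`, so EOM rows transport exactly; (iii) translation
rows transport to the SPIN-magnetic translations `T_{φv} W_{χ(v,·)}` (a constant phase per species).
[cite: ShastrySutherland1990] [cite: Lieb1994, eq. (1)] [cite: Han2020Bootstrap, §3]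
[cite: BratteliRobinsonII1997, §5.2.2]
-/

noncomputable section

open Matrix Finset
open Literature.MathematicalPhysics.QuantumLattice
open Literature.MathematicalPhysics.QuantumFieldTheory hiding Site
open Literature.MathematicalPhysics.QuantumManyBody.StateRelaxation
open Literature.Probability.LatticeModels
open HubbardWave0
open scoped ComplexOrder ComplexConjugate

namespace Summit.Ventures.CertifiedManyBodySolver.Rows

section SpinWindowGauge

variable {d d' N : ℕ} [NeZero N] (φ : Site d →+ TorusSite d' N)

/-! ### §1. `Ad(W_g)` and the spin-dependent Peierls Hamiltonian -/

/-- `Ad(W_g) H_{g·A} = H_A` for the orbital gauge. [cite: Lieb1994, eq. (1)] -/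
theorem orbGaugeAut_homHubbardSpinMag_homSpinGaugeTransform (g : TorusSite d' N → Fin 2 → Circle)
    (A : TorusSite d' N → Fin d → Fin 2 → Circle) (t U : ℝ) :
    orbGaugeAut (spinSitePhase g) (homHubbardSpinMag φ (homSpinGaugeTransform φ g A) t U) =
      homHubbardSpinMag φ A t U := by
  rw [orbGaugeAut_apply, orbPhaseGauge_mul_homHubbardSpinMag_mul_conjTranspose,
    homSpinGaugeTransform_inv_homSpinGaugeTransform]

/-! ### §2. Window gauges per species -/

/-- A window gauge composed with the site map of `S ⊆ Λ'`: `ĝ(homEmb y) = χ(y)`. [folklore] -/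
theorem spinWindowGauge_homEmb (χ : Site d → Fin 2 → Circle) (ĝ : TorusSite d' N → Fin 2 → Circle)
    {S Λ' : Finset (Site d)} (hS : S ⊆ Λ') (hInj' : Set.InjOn φ ↑Λ') (hĝ : ∀ x ∈ Λ', ĝ (φ x) = χ x)
    (y : PolySite S) :
    ĝ ((homEmb φ (hInj'.mono (by exact_mod_cast hS)) y).toTorusSite) = χ (ofLex y.1) := by
  rw [homEmb_apply, FermionTorus.toTorusSite_ofTorusSite]
  exact hĝ _ (hS (PolySite.ofLex_mem y))

/-! ### §3. The gauged tiling identity -/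

/-- **Gauged tiling identity (spin-dependent twist)**: the torus translates of the ORBITALLY gauged
embedded energy density `Ad(W_ĝ) Γ(ι_{Λ'}) Γ(incl) E_Φ` sum to the uniformly spin-twisted Peierls
Hamiltonian `H_κ` (phase `κ i σ` on every `φ(eᵢ)`-hop of species `σ`).
[cite: Lieb1994, eq. (1)] [cite: Han2020Bootstrap, §3] -/
theorem sum_fockTranslate_orbGaugeAut_homEmb_meanEnergyObs (t U : ℝ) (κ : Fin d → Fin 2 → Circle)
    (χ : Site d → Fin 2 → Circle) (hχ : ∀ σ x y, χ (x + y) σ = χ x σ * χ y σ)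
    (hχe : ∀ i σ, χ (unitVec i) σ = κ i σ) (ĝ : TorusSite d' N → Fin 2 → Circle)
    {Λ' : Finset (Site d)} (h0 : thicken ({0} : Finset (Site d)) 1 ⊆ Λ') (hInj' : Set.InjOn φ ↑Λ')
    (hĝ : ∀ x ∈ Λ', ĝ (φ x) = χ x) :
    ∑ v : TorusSite d' N, (fockTranslate v).val *
        orbGaugeAut (spinSitePhase ĝ)
          (fermionEmbed (homEmb φ hInj')
            (fermionEmbed (PolySite.incl h0) ((hubbardFermionInteraction d t U).meanEnergyObs 1))) *
        (fockTranslate v).valᴴ =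
      homHubbardSpinMag φ (fun _ => κ) t U := by
  letI instDE : DecidableEq (FermionTorus d' N) := LinearOrder.toDecidableEq
  have hInj0 : Set.InjOn φ ↑(thicken ({0} : Finset (Site d)) 1) := hInj'.mono (by exact_mod_cast h0)
  set o : TorusSite d' N → FermionTorus d' N := FermionTorus.ofTorusSite with ho
  set cd : TorusSite d' N → Fin 2 → Matrix (Finset (Orb (FermionTorus d' N))) (Finset (Orb (FermionTorus d' N))) ℂ :=
    fun x σ => creation (orb (o x) σ) with hcd
  set c : TorusSite d' N → Fin 2 → Matrix (Finset (Orb (FermionTorus d' N))) (Finset (Orb (FermionTorus d' N))) ℂ :=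
    fun x σ => annihilation (orb (o x) σ) with hc
  set nn : TorusSite d' N → Matrix (Finset (Orb (FermionTorus d' N))) (Finset (Orb (FermionTorus d' N))) ℂ :=
    fun x => numberOp (o x) 0 * numberOp (o x) 1 with hnn
  -- the window gauge at `0` and `±φ(eᵢ)`, species by species
  have hχ0 : ∀ σ, χ 0 σ = 1 := fun σ => mulChar_zero (fun x => χ x σ) (hχ σ)
  have hχn : ∀ σ x, χ (-x) σ = (χ x σ)⁻¹ := fun σ x => mulChar_neg (fun x => χ x σ) (hχ σ) x
  have hg0 : ∀ σ, (spinSitePhase ĝ (orb (FermionTorus.ofTorusSite (0 : TorusSite d' N)) σ) : ℂ) = 1 := by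
    intro σ
    rw [spinSitePhase_orb, FermionTorus.toTorusSite_ofTorusSite, ← map_zero φ,
      hĝ _ (h0 (zero_mem_thicken_zero 1)), hχ0, Circle.coe_one]
  have hgp : ∀ (i : Fin d) σ, (spinSitePhase ĝ (orb (FermionTorus.ofTorusSite (φ (unitVec i))) σ) : ℂ) =
      (κ i σ : ℂ) := by
    intro i σ
    rw [spinSitePhase_orb, FermionTorus.toTorusSite_ofTorusSite, hĝ _ (h0 (unitVec_mem_thicken_one i)), hχe]
  have hgm : ∀ (i : Fin d) σ, (spinSitePhase ĝ (orb (FermionTorus.ofTorusSite (-φ (unitVec i))) σ) : ℂ) =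
      conj (κ i σ : ℂ) := by
    intro i σ
    rw [spinSitePhase_orb, FermionTorus.toTorusSite_ofTorusSite, ← map_neg,
      hĝ _ (h0 (neg_unitVec_mem_thicken_one i)), hχn, hχe, Circle.coe_inv_eq_conj]
  have hcomm : ∀ (w : TorusSite d' N) (i : Fin d), φ (unitVec i) + w = w + φ (unitVec i) :=
    fun w i => add_comm _ _
  -- the translate by `v` of the gauged window energy density
  have htrans : ∀ v : TorusSite d' N, (fockTranslate v).val *
      orbGaugeAut (spinSitePhase ĝ) (fermionEmbed (homEmb φ hInj')
        (fermionEmbed (PolySite.incl h0) ((hubbardFermionInteraction d t U).meanEnergyObs 1))) *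
      (fockTranslate v).valᴴ =
      (U : ℂ) • nn v + ∑ i : Fin d, ((2 : ℂ)⁻¹ * -(t : ℂ)) • ∑ σ : Fin 2,
        ((conj (κ i σ : ℂ) • (cd v σ * c (v + φ (unitVec i)) σ) +
            (κ i σ : ℂ) • (cd (v + φ (unitVec i)) σ * c v σ)) +
          (conj (κ i σ : ℂ) • (cd (v - φ (unitVec i)) σ * c v σ) +
            (κ i σ : ℂ) • (cd v σ * c (v - φ (unitVec i)) σ))) := by
    intro v
    rw [← relabel_eq_fockRelabel_conj, fermionEmbed_homEmb_incl φ h0 hInj',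
      fermionEmbed_homEmb_hubbard_meanEnergyObs φ t U hInj0]
    simp only [map_add, map_smul, map_sum, map_mul, orbGaugeAut_creation, orbGaugeAut_annihilation,
      orbGaugeAut_numberOp, hg0, hgp, hgm, map_one, one_smul, Complex.conj_conj,
      relabel_translate_creation, relabel_translate_annihilation,
      relabel_translate_numberOp, zero_add, neg_add_eq_sub, hcomm, smul_mul_assoc, mul_smul_comm]
    rfl
  simp_rw [htrans]
  rw [Finset.sum_add_distrib, ← Finset.smul_sum, Finset.sum_comm]
  have hH : homHubbardSpinMag φ (fun _ => κ) t U =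
      -(t : ℂ) • (∑ x : TorusSite d' N, ∑ i : Fin d, ∑ σ : Fin 2,
        ((κ i σ : ℂ) • (cd (x + φ (unitVec i)) σ * c x σ) +
          conj (κ i σ : ℂ) • (cd x σ * c (x + φ (unitVec i)) σ))) +
        (U : ℂ) • ∑ x : TorusSite d' N, nn x :=
    homHubbardSpinMag_eq_sum_torusSite φ (fun _ => κ) t U
  rw [hH, add_comm]
  refine congrArg₂ (fun S T => S + (U : ℂ) • T) ?_ rfl
  simp only [Finset.smul_sum]
  conv_rhs => rw [Finset.sum_comm]
  refine Finset.sum_congr rfl fun i _ => ?_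
  have hshift1 : ∑ v : TorusSite d' N, ∑ σ : Fin 2, ((2 : ℂ)⁻¹ * -(t : ℂ)) •
      (conj (κ i σ : ℂ) • (cd (v - φ (unitVec i)) σ * c v σ)) =
      ∑ v : TorusSite d' N, ∑ σ : Fin 2, ((2 : ℂ)⁻¹ * -(t : ℂ)) •
        (conj (κ i σ : ℂ) • (cd v σ * c (v + φ (unitVec i)) σ)) :=
    TorusSite.sum_sub_shift (φ (unitVec i))
      (fun a b => ∑ σ : Fin 2, ((2 : ℂ)⁻¹ * -(t : ℂ)) • (conj (κ i σ : ℂ) • (cd b σ * c a σ)))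
  have hshift2 : ∑ v : TorusSite d' N, ∑ σ : Fin 2, ((2 : ℂ)⁻¹ * -(t : ℂ)) •
      ((κ i σ : ℂ) • (cd v σ * c (v - φ (unitVec i)) σ)) =
      ∑ v : TorusSite d' N, ∑ σ : Fin 2, ((2 : ℂ)⁻¹ * -(t : ℂ)) •
        ((κ i σ : ℂ) • (cd (v + φ (unitVec i)) σ * c v σ)) :=
    TorusSite.sum_sub_shift (φ (unitVec i))
      (fun a b => ∑ σ : Fin 2, ((2 : ℂ)⁻¹ * -(t : ℂ)) • ((κ i σ : ℂ) • (cd a σ * c b σ)))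
  simp only [smul_add, Finset.sum_add_distrib]
  rw [hshift1, hshift2]
  have ha : ∀ z : ℂ, -(t : ℂ) * z = (2 : ℂ)⁻¹ * -(t : ℂ) * z + (2 : ℂ)⁻¹ * -(t : ℂ) * z := fun z => by ring
  rw [← Finset.sum_add_distrib, ← Finset.sum_add_distrib, ← Finset.sum_add_distrib]
  refine Finset.sum_congr rfl fun v _ => ?_
  rw [← Finset.sum_add_distrib, ← Finset.sum_add_distrib, ← Finset.sum_add_distrib]
  refine Finset.sum_congr rfl fun σ _ => ?_
  simp only [smul_smul]
  rw [ha (κ i σ : ℂ), ha (conj (κ i σ : ℂ)), add_smul, add_smul]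
  abel

/-! ### §4. The gauged field is trivial on every bond the EOM rows see -/

omit [NeZero N] in
/-- **A window gauge removes the uniform spin-dependent field near `φ(Λ)`.** [cite: Lieb1994, eq. (1)] -/
theorem homSpinGaugeTransform_windowGauge_eq_one (κ : Fin d → Fin 2 → Circle) (χ : Site d → Fin 2 → Circle)
    (hχ : ∀ σ x y, χ (x + y) σ = χ x σ * χ y σ) (hχe : ∀ i σ, χ (unitVec i) σ = κ i σ)
    (ĝ : TorusSite d' N → Fin 2 → Circle)
    {Λ Λ' : Finset (Site d)} (hΛ : Λ ⊆ Λ')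
    (hclosed : ∀ x ∈ Λ, ∀ i : Fin d, x + unitVec i ∈ Λ' ∧ x - unitVec i ∈ Λ')
    (hĝ : ∀ x ∈ Λ', ĝ (φ x) = χ x) (x : TorusSite d' N) (i : Fin d)
    (h : (∃ z ∈ Λ, x = φ z) ∨ (∃ z ∈ Λ, x + φ (unitVec i) = φ z)) (σ : Fin 2) :
    homSpinGaugeTransform φ ĝ (fun _ => κ) x i σ = 1 := by
  obtain ⟨z₀, hz₀, hz₁, hx⟩ : ∃ z₀ : Site d, z₀ ∈ Λ' ∧ z₀ + unitVec i ∈ Λ' ∧ x = φ z₀ := by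
    rcases h with ⟨z, hz, hx'⟩ | ⟨z, hz, hx'⟩
    · exact ⟨z, hΛ hz, (hclosed z hz i).1, hx'⟩
    · refine ⟨z - unitVec i, (hclosed z hz i).2, by rw [sub_add_cancel]; exact hΛ hz, ?_⟩
      rw [map_sub, ← hx', add_sub_cancel_right]
  have hshift : x + φ (unitVec i) = φ (z₀ + unitVec i) := by rw [map_add, hx]
  simp only [homSpinGaugeTransform]
  rw [hshift, hx, hĝ _ hz₀, hĝ _ hz₁, hχ, hχe]
  exact mul_inv_cancel _

/-- **The gauge defect is localised away from `φ(Λ)`** (spin-dependent field): `H_{ĝ·κ} − H_1` lies in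
the even CAR algebra of the orbitals off `φ(Λ)`. [cite: BratteliRobinsonII1997, §5.2.2] -/
theorem homHubbardSpinMag_windowGauge_sub_one_mem [DecidableEq (FermionTorus d' N)] (t U : ℝ)
    (κ : Fin d → Fin 2 → Circle) (χ : Site d → Fin 2 → Circle)
    (hχ : ∀ σ x y, χ (x + y) σ = χ x σ * χ y σ) (hχe : ∀ i σ, χ (unitVec i) σ = κ i σ)
    (ĝ : TorusSite d' N → Fin 2 → Circle) {Λ Λ' : Finset (Site d)}
    (hΛ : Λ ⊆ Λ') (hclosed : ∀ x ∈ Λ, ∀ i : Fin d, x + unitVec i ∈ Λ' ∧ x - unitVec i ∈ Λ')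
    (hInj' : Set.InjOn φ ↑Λ') (hĝ : ∀ x ∈ Λ', ĝ (φ x) = χ x) :
    homHubbardSpinMag φ (homSpinGaugeTransform φ ĝ (fun _ => κ)) t U - homHubbardSpinMag φ 1 t U ∈
      carEvenSubalgebra (orbs ((Finset.univ : Finset (PolySite Λ)).map
        ((PolySite.incl hΛ).trans (homEmb φ hInj'))))ᶜ := by
  obtain rfl : ‹DecidableEq (FermionTorus d' N)› = LinearOrder.toDecidableEq := Subsingleton.elim _ _
  letI instDE : DecidableEq (FermionTorus d' N) := LinearOrder.toDecidableEq
  have hmem : ∀ y : TorusSite d' N, (∀ z ∈ Λ, y ≠ φ z) → ∀ τ : Fin 2,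
      orb (FermionTorus.ofTorusSite y) τ ∈ (orbs ((Finset.univ : Finset (PolySite Λ)).map
        ((PolySite.incl hΛ).trans (homEmb φ hInj'))))ᶜ := by
    intro y hy τ
    refine Finset.mem_compl.2 fun h' => ?_
    obtain ⟨p, -, hp⟩ := Finset.mem_map.1 (orb_mem_orbs.1 h')
    have h2 : FermionTorus.ofTorusSite (φ (ofLex p.1)) = FermionTorus.ofTorusSite y := by
      rw [← hp, Function.Embedding.trans_apply, homEmb_apply, PolySite.coe_incl]
    have h3 := congrArg FermionTorus.toTorusSite h2
    rw [FermionTorus.toTorusSite_ofTorusSite, FermionTorus.toTorusSite_ofTorusSite] at h3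
    exact hy (ofLex p.1) (PolySite.ofLex_mem p) h3.symm
  set A' := homSpinGaugeTransform φ ĝ (fun _ => κ) with hA'
  unfold homHubbardSpinMag
  rw [add_sub_add_right_eq_sub, ← smul_sub]
  refine SMulMemClass.smul_mem _ ?_
  rw [← Finset.sum_sub_distrib]
  refine sum_mem fun x _ => ?_
  rw [← Finset.sum_sub_distrib]
  refine sum_mem fun i _ => ?_
  rw [← Finset.sum_sub_distrib]
  refine sum_mem fun σ _ => ?_
  by_cases h : (∃ z ∈ Λ, x = φ z) ∨ (∃ z ∈ Λ, x + φ (unitVec i) = φ z)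
  · have h1 : A' x i σ = 1 :=
      homSpinGaugeTransform_windowGauge_eq_one φ κ χ hχ hχe ĝ hΛ hclosed hĝ x i h σ
    rw [h1, Pi.one_apply, Pi.one_apply, Pi.one_apply, sub_self]
    exact zero_mem _
  · push Not at h
    have hxS : ∀ τ, orb (FermionTorus.ofTorusSite x) τ ∈ (orbs ((Finset.univ : Finset (PolySite Λ)).map
        ((PolySite.incl hΛ).trans (homEmb φ hInj'))))ᶜ := hmem x h.1
    have hyS : ∀ τ, orb (FermionTorus.ofTorusSite (x + φ (unitVec i))) τ ∈
        (orbs ((Finset.univ : Finset (PolySite Λ)).map ((PolySite.incl hΛ).trans (homEmb φ hInj'))))ᶜ :=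
      hmem _ h.2
    refine sub_mem (add_mem (SMulMemClass.smul_mem _ ?_) (SMulMemClass.smul_mem _ ?_))
      (add_mem (SMulMemClass.smul_mem _ ?_) (SMulMemClass.smul_mem _ ?_))
    · exact creation_mul_annihilation_mem_carEvenSubalgebra (hyS σ) (hxS σ)
    · exact creation_mul_annihilation_mem_carEvenSubalgebra (hxS σ) (hyS σ)
    · exact creation_mul_annihilation_mem_carEvenSubalgebra (hyS σ) (hxS σ)
    · exact creation_mul_annihilation_mem_carEvenSubalgebra (hxS σ) (hyS σ)

/-! ### §5. Transport of the EOM and translation rows through `Ad(W_ĝ) ∘ Γ(ι_{Λ'})` -/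

/-- **EOM rows in the spin-twisted torus**: `Φ = Ad(W_ĝ) ∘ Γ(ι_{Λ'})` carries the window commutator
`[h_{Λ'}, Γ(incl) B]` to the torus commutator `[H_κ, Φ(Γ(incl) B)]`.
[cite: Han2020Bootstrap, §3] [cite: Lieb1994, eq. (1)] -/
theorem homHubbardSpinMag_commutator_orbGaugeAut_fermionEmbed (t U : ℝ) (κ : Fin d → Fin 2 → Circle)
    (χ : Site d → Fin 2 → Circle) (hχ : ∀ σ x y, χ (x + y) σ = χ x σ * χ y σ)
    (hχe : ∀ i σ, χ (unitVec i) σ = κ i σ) (ĝ : TorusSite d' N → Fin 2 → Circle)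
    (hd : Function.Injective (signedHop φ)) {Λ Λ' : Finset (Site d)} (hΛ : Λ ⊆ Λ')
    (hclosed : ∀ x ∈ Λ, ∀ i : Fin d, x + unitVec i ∈ Λ' ∧ x - unitVec i ∈ Λ')
    (hInj' : Set.InjOn φ ↑Λ') (hĝ : ∀ x ∈ Λ', ĝ (φ x) = χ x) (B : FermionOp Λ) :
    homHubbardSpinMag φ (fun _ => κ) t U *
          orbGaugeAut (spinSitePhase ĝ)
            (fermionEmbed (homEmb φ hInj') (fermionEmbed (PolySite.incl hΛ) B)) -
        orbGaugeAut (spinSitePhase ĝ)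
            (fermionEmbed (homEmb φ hInj') (fermionEmbed (PolySite.incl hΛ) B)) *
          homHubbardSpinMag φ (fun _ => κ) t U =
      orbGaugeAut (spinSitePhase ĝ)
        (fermionEmbed (homEmb φ hInj')
          ((hubbardFermionInteraction d t U).localHamiltonian Λ' * fermionEmbed (PolySite.incl hΛ) B -
            fermionEmbed (PolySite.incl hΛ) B * (hubbardFermionInteraction d t U).localHamiltonian Λ')) := by
  letI instDE : DecidableEq (FermionTorus d' N) := LinearOrder.toDecidableEq
  set H' := homHubbardSpinMag φ (homSpinGaugeTransform φ ĝ (fun _ => κ)) t U with hH'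
  set Z := fermionEmbed (homEmb φ hInj') (fermionEmbed (PolySite.incl hΛ) B) with hZ
  have hgauge : homHubbardSpinMag φ (fun _ => κ) t U = orbGaugeAut (spinSitePhase ĝ) H' :=
    (orbGaugeAut_homHubbardSpinMag_homSpinGaugeTransform φ ĝ (fun _ => κ) t U).symm
  have hcomm : (H' - homHubbard φ t U) * Z = Z * (H' - homHubbard φ t U) := by
    have hm := homHubbardSpinMag_windowGauge_sub_one_mem φ t U κ χ hχ hχe ĝ hΛ hclosed hInj' hĝ
    rw [homHubbardSpinMag_one_eq_homHubbard φ hd t U] at hm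
    rw [hZ, fermionEmbed_fermionEmbed]
    exact (commute_of_mem_carEvenSubalgebra hm (fermionEmbed_mem_carSubalgebra _ B) disjoint_compl_left).eq
  have hsharp := homHubbard_commutator_fermionEmbed φ t U hΛ hclosed hInj' B
  rw [← hZ] at hsharp
  rw [hgauge, ← map_mul (orbGaugeAut (spinSitePhase ĝ)), ← map_mul (orbGaugeAut (spinSitePhase ĝ)),
    ← map_sub (orbGaugeAut (spinSitePhase ĝ)), ← hsharp]
  congr 1
  have e : H' = homHubbard φ t U + (H' - homHubbard φ t U) := by abel
  rw [e, Matrix.add_mul, Matrix.mul_add, hcomm]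
  abel

/-- **Translation rows in the spin-twisted torus**: `Φ = Ad(W_ĝ) ∘ Γ(ι_{Λ'})` carries the window row
`Γ(incl')(τ_v Y) − Γ(incl) Y` to `U (Φ Y) Uᴴ − Φ Y` with the SPIN-MAGNETIC TRANSLATION
`U = T_{φ v} · W_{χ(v,·)}` (one constant phase per species). [cite: Lieb1994, eq. (1)] -/
theorem orbGaugeAut_homEmb_shift_sub (χ : Site d → Fin 2 → Circle) (hχ : ∀ σ x y, χ (x + y) σ = χ x σ * χ y σ)
    (ĝ : TorusSite d' N → Fin 2 → Circle) {Λ Λ' : Finset (Site d)} (hΛ : Λ ⊆ Λ') (v : Site d)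
    (hsh : shiftSet v Λ ⊆ Λ') (hInj' : Set.InjOn φ ↑Λ') (hĝ : ∀ x ∈ Λ', ĝ (φ x) = χ x) (Y : FermionOp Λ) :
    orbGaugeAut (spinSitePhase ĝ)
        (fermionEmbed (homEmb φ hInj')
          (fermionEmbed (PolySite.incl hsh) (fermionEmbed (PolySite.shiftEmb v Λ) Y) -
            fermionEmbed (PolySite.incl hΛ) Y)) =
      ((fockTranslate (φ v)).val * orbPhaseGauge (spinSitePhase (fun _ : TorusSite d' N => χ v))) *
          orbGaugeAut (spinSitePhase ĝ)
            (fermionEmbed (homEmb φ (hInj'.mono (by exact_mod_cast hΛ))) Y) *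
          ((fockTranslate (φ v)).val * orbPhaseGauge (spinSitePhase (fun _ : TorusSite d' N => χ v)))ᴴ -
        orbGaugeAut (spinSitePhase ĝ)
          (fermionEmbed (homEmb φ (hInj'.mono (by exact_mod_cast hΛ))) Y) := by
  letI instDE : DecidableEq (FermionTorus d' N) := LinearOrder.toDecidableEq
  set G : Orb (FermionTorus d' N) → Circle := spinSitePhase ĝ with hG
  set C : Orb (FermionTorus d' N) → Circle := spinSitePhase (fun _ : TorusSite d' N => χ v) with hC
  have hInjΛ : Set.InjOn φ ↑Λ := hInj'.mono (by exact_mod_cast hΛ)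
  have hInjS : Set.InjOn φ ↑(shiftSet v Λ) := hInj'.mono (by exact_mod_cast hsh)
  -- on `Λ`, the window gauge pulled back along the shift is the constant-per-species `χ(v,σ)` times the window gauge
  have hfun : (G ∘ orbMap (homEmb φ hInjS)) ∘ orbMap (PolySite.shiftEmb v Λ) =
      (C ∘ orbMap (homEmb φ hInjΛ)) * (G ∘ orbMap (homEmb φ hInjΛ)) := by
    funext y
    simp only [Function.comp_apply, Pi.mul_apply, hG, hC, orbMap, spinSitePhase_orb]
    rw [spinWindowGauge_homEmb φ χ ĝ hsh hInj' hĝ, spinWindowGauge_homEmb φ χ ĝ hΛ hInj' hĝ]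
    simp only [orb, ofLex_toLex]
    rw [PolySite.ofLex_coe_shiftEmb, hχ, mul_comm]
  rw [map_sub, fermionEmbed_homEmb_incl φ hsh hInj', fermionEmbed_homEmb_incl φ hΛ hInj', map_sub,
    orbGaugeAut_fermionEmbed G (homEmb φ hInjS), orbGaugeAut_fermionEmbed, hfun, orbGaugeAut_mul_apply,
    fermionEmbed_homEmb_shiftEmb φ v hInjΛ hInjS, relabel_eq_fockRelabel_conj]
  have hconst : fermionEmbed (homEmb φ hInjΛ)
      (orbGaugeAut (C ∘ orbMap (homEmb φ hInjΛ)) (orbGaugeAut (G ∘ orbMap (homEmb φ hInjΛ)) Y)) =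
      orbGaugeAut C (orbGaugeAut G (fermionEmbed (homEmb φ hInjΛ) Y)) := by
    rw [orbGaugeAut_fermionEmbed G, orbGaugeAut_fermionEmbed C]
  rw [hconst, orbGaugeAut_apply C, conjTranspose_mul]
  simp only [Matrix.mul_assoc]

end SpinWindowGauge

end Summit.Ventures.CertifiedManyBodySolver.Rows
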